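import Literature.MathematicalPhysics.QuantumFieldTheory.BalabanImbrieJaffe1984to88.BIJ88ObservableFactorization312
import Literature.MathematicalPhysics.QuantumFieldTheory.BalabanImbrieJaffe1984to88.BIJ88Result5145

/-!
# `BalabanImbrieJaffe1984to88.BIJ88Result5145Obs` — T. Bałaban, J. Imbrie, A. Jaffe, *Effective action and cluster properties of the abelian
Higgs model*, Commun. Math. Phys. **114** (1988) 257–315 [BalabanImbrieJaffe1988]: Sect. 5.14, p. 312 [PDF 56] — the second display of p. 312 in
the PRINTED INDEX SET of `BIJ88Result5145.remFamilies` (*"The X_{r′} are disjoint, and each one covers at least one X_{σ₁}"*), the interacting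
expectation `⟨Π F⟩₁ = z_F/z` of `BIJ88Result5145.expect1` EQUAL to the derived sum `Σ_{{X_{r′}}} Π_{r′} G_k(X_{r′})`, and **(5.14.5) with the hypothesis
`h312` of `BIJ88Result5145.eq5145` DISCHARGED** from the printed inputs (polymer-gas representations of `z_F` and `z`, Kotecký–Preiss smallness).

HONEST FRAMING (cell `lit-balaban`, verbatim): statement-level skeleton of published theorems with citation tags; proofs where landed; nothing here is a claim about the Yang–Mills mass gap.

PDF held: `paper:balaban1988-cmp114-bij-abelian-higgs-effective-action` (journal page = PDF page + 256); p. 308 = PDF p. 52, p. 312 = PDF p. 56.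

CITATION HEADER (verbatim).  p. 312 [PDF 56]: *"z_F/z = ⟨Π_{σ₁} F^{m̄}_{k,loc}(X_{σ₁})⟩₁ = … where ⟨·⟩₁ is the interacting expectation at t = 1. …
Without going into details, it is clear that the result can be written in the following form: ⟨Π_{σ₁} F^{m̄}_{k,loc}(X_{σ₁})⟩₁ = Σ_{{X_{r′}}} Π_{r′}
G_k(X_{r′}) Π_{c: X_c⊄∪_{r′}X_{r′}} F^L_{k+1,loc}(X_c). The X_{r′} are disjoint, and each one covers at least one X_{σ₁} … To summarize the results of
this section, we have e^{−V^{(k)}_{const}(Λ₈^{(k)})} Σ_{{X_α}} Π_α g₂(X_α) = Σ_{{X_α} overlapping Λ₁₁^{(k)c}} Π_α g₂(X_α) Σ_{{X_{r′}}} Π_{r′} G_k(X_{r′})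
× Π_{c} F^L_{k+1,loc}(X_c) exp(−𝒫^L_{k+1,loc}(Λ₈^{(k)}) − Σ_X W₆^{(k)}(X)). (5.14.5)"*.

WHAT IS REPRODUCED (unit `lit-balaban-p25`, generation 11 of the Phase-2 proof seat p25; SKELETON rows `C2.Claim@312` (second display) and
`C2.Eq5.14.5`; on `BIJ88ObservableFactorization312` (p25 g11: the display derived, `Gk` defined) and `BIJ88Result5145` (p25 g7: (5.14.5) assembled with
`h312` a displayed hypothesis); HOME `run/shared/lean/pub/lit-balaban/lit-balaban-p25/`).
§1 `isSetPartition_biUnion_iff`, **`remFamilies_filter_eq`** (the gen-7 index set `remFamilies (Rset.image loc) W′` of *"disjoint, each covering an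
  X_{σ₁}"* families, restricted to the covering ones, IS the index set of the derived display), `Gk_eq_zero_of_not_subset`, `sum_disjFamilies_superset`
  (the derived sum may be indexed by the families inside any larger set of cubes, e.g. the region Λ₁₂), **`obsRatio_eq_sum_remFamilies`**.
§2 **`expect1_eq_sum_remFamilies`** — for the model of `BIJ88Resummation5141`/`BIJ88Result5145` (linear expectations `E`, cut-off `χ`, observable product
  `F`, Boltzmann factors): if the un-normalized expectations `z_F = zF E (χ·F)` and `z = zF E χ` of a region are represented by the observable-carrying
  gas (`z_F = c · obsNumerator`, `z = c · Z(Λ)`, `c ≠ 0` — the content of the prime-dropped polymer expansions (5.13.4)/(5.14.3), rows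
  C2.Eq5.13.3-5.13.4 / C2.Eq5.14.3-5.14.4) and the vacuum activities are KP-small, then `⟨Π F⟩₁ = expect1 … = Σ_{ρ ∈ remFamilies, Cov} Π_{X′∈ρ} G_k(X′)`.
§3 **`eq5145_h312`** — (5.14.5) as in `BIJ88Result5145.eq5145` with the hypothesis `h312` (p. 312 second display, *"without going into details"*)
  REPLACED by the gas representations and KP smallness of every large-field-free region; the observable factor is the derived `Σ_{{X_{r′}}} Π G_k`.
HONEST SCOPE / READINGS: as in `BIJ88ObservableFactorization312` — the derived display is the remainder-expectation form (all observables of the region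
inserted; the perturbative constants F^L_{k+1,loc}(X_c) of the first display of p. 312 are not modelled), `h311` (p. 311) stays a displayed hypothesis,
no bound (`Ineq312`, (5.14.4)) is asserted; 0 `sorry`, 0 new `Prop` facts (D-0026).
-/

noncomputable section

open Finset
open Literature.Probability.LatticeModels (IsSetPartition setPartitions IsKPVolume polymerPartitionFunction)
open Literature.MathematicalPhysics.QuantumFieldTheory.BalabanImbrieJaffe1984to88.BIJ88ObservableGas312 (obsNumerator)
open Literature.MathematicalPhysics.QuantumFieldTheory.BalabanImbrieJaffe1984to88.BIJ88SupportRegrouping312 (asupp aggFiber aggWeight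
  mem_aggFiber disjFamilies mem_disjFamilies)
open Literature.MathematicalPhysics.QuantumFieldTheory.BalabanImbrieJaffe1984to88.BIJ88ObservableFactorization312
open Literature.MathematicalPhysics.QuantumFieldTheory.BalabanImbrieJaffe1984to88.BIJ88Resummation5141 (outer lam12 polysIn Compat restrictTo
  g2 zF zS)
open Literature.MathematicalPhysics.QuantumFieldTheory.BalabanImbrieJaffe1984to88.BIJ88Result5145 (expect1 remFamilies mem_remFamilies eq5145)

namespace Literature.MathematicalPhysics.QuantumFieldTheory.BalabanImbrieJaffe1984to88.BIJ88Result5145Obs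

variable {ι : Type*} [DecidableEq ι] {P : Type*} [DecidableEq P] {Q : Type*} [DecidableEq Q] {σ : Type*} [DecidableEq σ]

/-! ## §1 The printed index set `{X_{r′}}` and the derived sum -/

omit [DecidableEq ι] in
/-- a family is a set partition of its own union iff its members are nonempty and pairwise disjoint. [cite: BalabanImbrieJaffe1988, (5.14.5) p.312] -/
theorem isSetPartition_biUnion_iff [DecidableEq ι] (ρ : Finset (Finset ι)) :
    IsSetPartition (ρ.biUnion id) ρ ↔ (∀ X ∈ ρ, X.Nonempty) ∧ (ρ : Set (Finset ι)).PairwiseDisjoint id := by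
  unfold IsSetPartition
  constructor
  · rintro ⟨-, hempty, -, huniq⟩
    refine ⟨fun X hX => nonempty_iff_ne_empty.2 fun h => hempty (h ▸ hX), fun X hX Y hY hXY => ?_⟩
    exact disjoint_left.2 fun i hiX hiY => hXY (huniq X (mem_coe.1 hX) Y (mem_coe.1 hY) i hiX hiY)
  · rintro ⟨hne, hdisj⟩
    refine ⟨fun X hX => subset_biUnion_of_mem id hX, fun h => (hne ∅ h).ne_empty rfl, fun v hv => ?_, fun X hX Y hY v hvX hvY => ?_⟩
    · obtain ⟨X, hX, hv⟩ := mem_biUnion.1 hv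
      exact ⟨X, hX, hv⟩
    · by_contra hXY
      exact disjoint_left.1 (hdisj (mem_coe.2 hX) (mem_coe.2 hY) hXY) hvX hvY

omit [DecidableEq σ] in
/-- **the printed index set is the derived one**: the families of gen 7's `remFamilies (Rset.image loc) W′` (*"The X_{r′} are disjoint, and each one
covers at least one X_{σ₁}"*) which cover all inserted observables are exactly the covering families of pairwise disjoint nonempty subsets of `W′` each
containing an observable support. [cite: BalabanImbrieJaffe1988, (5.14.5) p.312] -/
theorem remFamilies_filter_eq (loc : σ → Finset ι) (Rset : Finset σ) (W' : Finset ι) :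
    (remFamilies (Rset.image loc) W').filter (Cov loc Rset) =
      (disjFamilies W').filter fun ρ => Cov loc Rset ρ ∧ ∀ X' ∈ ρ, ∃ r ∈ Rset, loc r ⊆ X' := by
  ext ρ
  rw [mem_filter, mem_filter, mem_remFamilies, mem_disjFamilies, isSetPartition_biUnion_iff]
  constructor
  · rintro ⟨⟨hW, ⟨hne, hdisj⟩, hcov⟩, hCov⟩
    refine ⟨⟨hW, hne, hdisj⟩, hCov, fun X' hX' => ?_⟩
    obtain ⟨S, hS, hSX⟩ := hcov X' hX'
    obtain ⟨r, hr, rfl⟩ := mem_image.1 hS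
    exact ⟨r, hr, hSX⟩
  · rintro ⟨⟨hW, hne, hdisj⟩, hCov, hcov⟩
    refine ⟨⟨hW, ⟨hne, hdisj⟩, fun X' hX' => ?_⟩, hCov⟩
    obtain ⟨r, hr, hrX⟩ := hcov X' hX'
    exact ⟨loc r, mem_image_of_mem loc hr, hrX⟩

variable {supp : P → Finset ι} {suppQ : Q → Finset ι} {obs : Q → Finset σ} {loc : σ → Finset ι} {Rset : Finset σ} {𝒬 : Finset Q}
  {Λ : Finset P}

/-- an aggregate not inside the support of the item universe has activity `G_k = 0` (no set of items fills it). [cite: BalabanImbrieJaffe1988, (5.14.5) p.312] -/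
theorem Gk_eq_zero_of_not_subset (wQ : Q → ℂ) (inc : P → P → Prop) [DecidableRel inc] (w : P → ℂ) {X' : Finset ι}
    (hX : ¬ X' ⊆ asupp (isuppO suppQ) (itemU supp 𝒬 Λ)) : Gk supp suppQ obs loc Rset 𝒬 wQ inc w Λ X' = 0 := by
  unfold Gk aggWeight
  refine sum_eq_zero fun K hK => ?_
  exfalso
  obtain ⟨hKU, -, -, hKX⟩ := mem_aggFiber.1 hK
  exact hX (hKX ▸ biUnion_subset_biUnion_of_subset_left _ hKU)

/-- the derived sum may be indexed by the families inside any larger set of cubes `W′ ⊇ asupp U` (e.g. the whole region Λ₁₂^{(k)}): the additional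
families contain an aggregate with `G_k = 0`. [cite: BalabanImbrieJaffe1988, (5.14.5) p.312] -/
theorem sum_disjFamilies_superset (wQ : Q → ℂ) (inc : P → P → Prop) [DecidableRel inc] (w : P → ℂ) {W' : Finset ι}
    (hW : asupp (isuppO suppQ) (itemU supp 𝒬 Λ) ⊆ W') (Φ : Finset (Finset ι) → Prop) [DecidablePred Φ] :
    ∑ ρ ∈ (disjFamilies W').filter Φ, ∏ X' ∈ ρ, Gk supp suppQ obs loc Rset 𝒬 wQ inc w Λ X' =
      ∑ ρ ∈ (disjFamilies (asupp (isuppO suppQ) (itemU supp 𝒬 Λ))).filter Φ, ∏ X' ∈ ρ, Gk supp suppQ obs loc Rset 𝒬 wQ inc w Λ X' := by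
  symm
  refine sum_subset (fun ρ hρ => ?_) fun ρ hρ hρ' => ?_
  · obtain ⟨hρ, hΦ⟩ := mem_filter.1 hρ
    obtain ⟨hsub, hne, hdisj⟩ := mem_disjFamilies.1 hρ
    exact mem_filter.2 ⟨mem_disjFamilies.2 ⟨fun X hX => (hsub X hX).trans hW, hne, hdisj⟩, hΦ⟩
  · obtain ⟨hρ, hΦ⟩ := mem_filter.1 hρ
    obtain ⟨hsub, hne, hdisj⟩ := mem_disjFamilies.1 hρ
    have : ¬ ∀ X ∈ ρ, X ⊆ asupp (isuppO suppQ) (itemU supp 𝒬 Λ) := fun h =>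
      hρ' (mem_filter.2 ⟨mem_disjFamilies.2 ⟨h, hne, hdisj⟩, hΦ⟩)
    push Not at this
    obtain ⟨X', hX', hX⟩ := this
    exact prod_eq_zero hX' (Gk_eq_zero_of_not_subset wQ inc w hX)

/-- **the second display of p. 312 in the printed index set**: in a Kotecký–Preiss volume, for every set of cubes `W′ ⊇ asupp U` (the region),
`obsNumerator / Z(Λ) = Σ_{ρ ∈ remFamilies (Rset.image loc) W′, ρ covering} Π_{X′∈ρ} G_k(X′)` — the sum over the families `{X_{r′}}` of gen 7's
`BIJ88Result5145.remFamilies` (*"disjoint, each one covers at least one X_{σ₁}"*) covering all inserted observables. [cite: BalabanImbrieJaffe1988, (5.14.5) p.312] -/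
theorem obsRatio_eq_sum_remFamilies {inc : P → P → Prop} [DecidableRel inc] [Std.Refl inc] [Std.Symm inc] {incQ : Q → P → Prop}
    [∀ X Y, Decidable (incQ X Y)] (hincQ : ∀ X Y, incQ X Y ↔ ¬ Disjoint (suppQ X) (supp Y))
    (hobs : ∀ X ∈ 𝒬, ∀ r ∈ obs X, r ∈ Rset ∧ loc r ⊆ suppQ X) (hobsne : ∀ X ∈ 𝒬, (obs X).Nonempty) (hloc : ∀ r ∈ Rset, (loc r).Nonempty)
    (wQ : Q → ℂ) {w : P → ℂ} {a : P → ℝ} (hKP : IsKPVolume inc w a Λ) {W' : Finset ι} (hW : asupp (isuppO suppQ) (itemU supp 𝒬 Λ) ⊆ W') :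
    obsNumerator inc incQ (decFamilies suppQ obs Rset 𝒬) wQ w Λ / polymerPartitionFunction inc w Λ =
      ∑ ρ ∈ (remFamilies (Rset.image loc) W').filter (Cov loc Rset), ∏ X' ∈ ρ, Gk supp suppQ obs loc Rset 𝒬 wQ inc w Λ X' := by
  rw [remFamilies_filter_eq, sum_disjFamilies_superset wQ inc w hW, obsRatio_eq_sum_covering_prod_Gk hincQ hobs hobsne hloc wQ hKP]

/-! ## §2 The interacting expectation `⟨Π F⟩₁ = z_F/z` of the model of `BIJ88Result5145` -/

/-- **`⟨Π_{σ₁} F(X_{σ₁})⟩₁ = Σ_{{X_{r′}}} Π_{r′} G_k(X_{r′})`** for the interacting expectation at `t = 1` of gen 7's `BIJ88Result5145.expect1` (`= z_F/z`,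
p. 312 first display): if the un-normalized expectations of the region `W′` are represented by the observable-carrying gas — `z_F = c · obsNumerator`
(the prime-dropped polymer expansion (5.14.3) with the observables as decorations, row C2.Eq5.14.3-5.14.4) and `z = c · Z(Λ)` (the expansion (5.13.4)
re-summed as a hard-core gas, row C2.Eq5.13.3-5.13.4; `c` = the common prefactor, e.g. `Π_□ g₂(□)`), `c ≠ 0` — and the vacuum activities satisfy the
Kotecký–Preiss condition (p. 310 *"a standard exercise … using (5.14.4)"*), then the normalized expectation is the derived finite sum over covering
families of pairwise disjoint aggregates inside `W′`. [cite: BalabanImbrieJaffe1988, (5.14.5) p.312] -/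
theorem expect1_eq_sum_remFamilies {Φ : Type*} (E : Finset ι → (Φ → ℝ) →ₗ[ℝ] ℝ) (χ F : Finset ι → Φ → ℝ) (Ys : Finset (Finset ι))
    (b : Finset ι → Φ → ℝ) (W' : Finset ι)
    {inc : P → P → Prop} [DecidableRel inc] [Std.Refl inc] [Std.Symm inc] {incQ : Q → P → Prop} [∀ X Y, Decidable (incQ X Y)]
    (hincQ : ∀ X Y, incQ X Y ↔ ¬ Disjoint (suppQ X) (supp Y))
    (hobs : ∀ X ∈ 𝒬, ∀ r ∈ obs X, r ∈ Rset ∧ loc r ⊆ suppQ X) (hobsne : ∀ X ∈ 𝒬, (obs X).Nonempty) (hloc : ∀ r ∈ Rset, (loc r).Nonempty)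
    (wQ : Q → ℂ) {w : P → ℂ} {a : P → ℝ} (hKP : IsKPVolume inc w a Λ) (hW : asupp (isuppO suppQ) (itemU supp 𝒬 Λ) ⊆ W') {c : ℂ} (hc : c ≠ 0)
    (hN : ((zF E (fun W => χ W * F W) Ys b W' : ℝ) : ℂ) = c * obsNumerator inc incQ (decFamilies suppQ obs Rset 𝒬) wQ w Λ)
    (hz : ((zF E χ Ys b W' : ℝ) : ℂ) = c * polymerPartitionFunction inc w Λ) :
    ((expect1 E χ Ys b W' (F W') : ℝ) : ℂ) =
      ∑ ρ ∈ (remFamilies (Rset.image loc) W').filter (Cov loc Rset), ∏ X' ∈ ρ, Gk supp suppQ obs loc Rset 𝒬 wQ inc w Λ X' := by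
  rw [← obsRatio_eq_sum_remFamilies hincQ hobs hobsne hloc wQ hKP hW, ← BIJ88Result5145.zF_div_z_eq_expect1, Complex.ofReal_div, hN, hz,
    mul_div_mul_left _ _ hc]

/-- the same as a real number (the derived sum is real, being equal to a real expectation). [cite: BalabanImbrieJaffe1988, (5.14.5) p.312] -/
theorem expect1_eq_re_sum_remFamilies {Φ : Type*} (E : Finset ι → (Φ → ℝ) →ₗ[ℝ] ℝ) (χ F : Finset ι → Φ → ℝ) (Ys : Finset (Finset ι))
    (b : Finset ι → Φ → ℝ) (W' : Finset ι)
    {inc : P → P → Prop} [DecidableRel inc] [Std.Refl inc] [Std.Symm inc] {incQ : Q → P → Prop} [∀ X Y, Decidable (incQ X Y)]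
    (hincQ : ∀ X Y, incQ X Y ↔ ¬ Disjoint (suppQ X) (supp Y))
    (hobs : ∀ X ∈ 𝒬, ∀ r ∈ obs X, r ∈ Rset ∧ loc r ⊆ suppQ X) (hobsne : ∀ X ∈ 𝒬, (obs X).Nonempty) (hloc : ∀ r ∈ Rset, (loc r).Nonempty)
    (wQ : Q → ℂ) {w : P → ℂ} {a : P → ℝ} (hKP : IsKPVolume inc w a Λ) (hW : asupp (isuppO suppQ) (itemU supp 𝒬 Λ) ⊆ W') {c : ℂ} (hc : c ≠ 0)
    (hN : ((zF E (fun W => χ W * F W) Ys b W' : ℝ) : ℂ) = c * obsNumerator inc incQ (decFamilies suppQ obs Rset 𝒬) wQ w Λ)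
    (hz : ((zF E χ Ys b W' : ℝ) : ℂ) = c * polymerPartitionFunction inc w Λ) :
    expect1 E χ Ys b W' (F W') =
      (∑ ρ ∈ (remFamilies (Rset.image loc) W').filter (Cov loc Rset), ∏ X' ∈ ρ, Gk supp suppQ obs loc Rset 𝒬 wQ inc w Λ X').re := by
  rw [← expect1_eq_sum_remFamilies E χ F Ys b W' hincQ hobs hobsne hloc wQ hKP hW hc hN hz, Complex.ofReal_re]

/-! ## §3 (5.14.5) with `h312` discharged -/

/-- **(5.14.5) p. 312 [PDF 56] with the hypothesis `h312` of `BIJ88Result5145.eq5145` DISCHARGED.** The display (5.14.5) (verbatim in the citation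
header) in the model of `BIJ88Resummation5141`, from the hypotheses of `BIJ88Result5145.eq5145` — (5.14.1) `hYs`/`hg`/`hdec`, `hz` (z > 0), `hlogz`
((5.14.2) split), `hrem` (ℛ_k = Σ W₆′), `h311` (p. 311, displayed) — EXCEPT `h312`, which is replaced, for every large-field-free region `W′`, by the
observable-carrying gas data of that region (vacuum polymers `Λg W′` with activities `wv W′`, decorated polymers `𝒬g W′` with activities `wQ W′`,
inserted observables `Rg W′`, incompatibility = overlap), the covering convention, KP smallness, and the gas representations of `z_F` and `z`
(`hN`, `hZ`, prefactor `c W′ ≠ 0`); the observable factor of (5.14.5) is then the DERIVED `Σ_{{X_{r′}} ∈ remFamilies, covering} Π_{r′} G_k(X_{r′})`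
(real part; it is real). [cite: BalabanImbrieJaffe1988, (5.14.5) p.312] -/
theorem eq5145_h312 {Φ : Type*} (W B : Finset ι) (g : Finset ι → ℝ) (E : Finset ι → (Φ → ℝ) →ₗ[ℝ] ℝ) (χ F : Finset ι → Φ → ℝ)
    (Ys : Finset (Finset ι)) (b : Finset ι → Φ → ℝ) (g₁ : Finset ι → Finset (Finset ι) → ℝ)
    (hYs : ∀ Y ∈ Ys, Y.Nonempty) (hg : ∀ X ⊆ W, X.Nonempty → Disjoint X B → g X = g2 Ys g₁ X)
    (hdec : ∀ W' ⊆ W, Disjoint W' B → ∀ S ⊆ polysIn Ys W',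
      zS E (fun W => χ W * F W) b W' S = ∑ κ ∈ setPartitions W', if Compat κ S then ∏ X ∈ κ, g₁ X (restrictTo S X) else 0)
    (Vconst PL : ℝ) (𝒳 : Finset (Finset ι)) (pert rem : Finset ι → ℝ) (W6p W6pp : Finset ι → Finset ι → ℝ)
    (hz : ∀ W' ⊆ W, Disjoint W' B → 0 < zF E χ Ys b W')
    (hlogz : ∀ W' ⊆ W, Disjoint W' B → Real.log (zF E χ Ys b W') = -pert W' - rem W')
    (hrem : ∀ W' ⊆ W, Disjoint W' B → rem W' = ∑ X ∈ 𝒳, W6p W' X)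
    (h311 : ∀ W' ⊆ W, Disjoint W' B → Vconst + pert W' = PL + ∑ X ∈ 𝒳, W6pp W' X)
    -- the observable-carrying gas of each region, replacing `h312`
    (inc : P → P → Prop) [DecidableRel inc] [Std.Refl inc] [Std.Symm inc] (incQ : Q → P → Prop) [∀ X Y, Decidable (incQ X Y)]
    (hincQ : ∀ X Y, incQ X Y ↔ ¬ Disjoint (suppQ X) (supp Y))
    (Λg : Finset ι → Finset P) (𝒬g : Finset ι → Finset Q) (Rg : Finset ι → Finset σ) (wv : Finset ι → P → ℂ) (wQ : Finset ι → Q → ℂ)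
    (a : Finset ι → P → ℝ) (c : Finset ι → ℂ)
    (hobs : ∀ W' ⊆ W, Disjoint W' B → ∀ X ∈ 𝒬g W', ∀ r ∈ obs X, r ∈ Rg W' ∧ loc r ⊆ suppQ X)
    (hobsne : ∀ W' ⊆ W, Disjoint W' B → ∀ X ∈ 𝒬g W', (obs X).Nonempty)
    (hloc : ∀ W' ⊆ W, Disjoint W' B → ∀ r ∈ Rg W', (loc r).Nonempty)
    (hKP : ∀ W' ⊆ W, Disjoint W' B → IsKPVolume inc (wv W') (a W') (Λg W'))
    (hU : ∀ W' ⊆ W, Disjoint W' B → asupp (isuppO suppQ) (itemU supp (𝒬g W') (Λg W')) ⊆ W')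
    (hc : ∀ W' ⊆ W, Disjoint W' B → c W' ≠ 0)
    (hN : ∀ W' ⊆ W, Disjoint W' B → ((zF E (fun W => χ W * F W) Ys b W' : ℝ) : ℂ) =
      c W' * obsNumerator inc incQ (decFamilies suppQ obs (Rg W') (𝒬g W')) (wQ W') (wv W') (Λg W'))
    (hZ : ∀ W' ⊆ W, Disjoint W' B → ((zF E χ Ys b W' : ℝ) : ℂ) = c W' * polymerPartitionFunction inc (wv W') (Λg W')) :
    Real.exp (-Vconst) * ∑ π ∈ setPartitions W, ∏ X ∈ π, g X =
      ∑ ρ ∈ outer W B, (∏ X ∈ ρ, g X) *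
        ((∑ ρ' ∈ (remFamilies ((Rg (lam12 W ρ)).image loc) (lam12 W ρ)).filter (Cov loc (Rg (lam12 W ρ))),
            ∏ X' ∈ ρ', Gk supp suppQ obs loc (Rg (lam12 W ρ)) (𝒬g (lam12 W ρ)) (wQ (lam12 W ρ)) inc (wv (lam12 W ρ)) (Λg (lam12 W ρ)) X').re *
          Real.exp (-PL - ∑ X ∈ 𝒳, (W6p (lam12 W ρ) X + W6pp (lam12 W ρ) X))) :=
  eq5145 W B g E χ F Ys b g₁ hYs hg hdec Vconst PL 𝒳 pert rem
    (fun W' => (∑ ρ' ∈ (remFamilies ((Rg W').image loc) W').filter (Cov loc (Rg W')),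
      ∏ X' ∈ ρ', Gk supp suppQ obs loc (Rg W') (𝒬g W') (wQ W') inc (wv W') (Λg W') X').re)
    W6p W6pp hz hlogz hrem h311 fun W' hW' hdis =>
      expect1_eq_re_sum_remFamilies E χ F Ys b W' hincQ (hobs W' hW' hdis) (hobsne W' hW' hdis) (hloc W' hW' hdis) (wQ W')
        (hKP W' hW' hdis) (hU W' hW' hdis) (hc W' hW' hdis) (hN W' hW' hdis) (hZ W' hW' hdis)

end Literature.MathematicalPhysics.QuantumFieldTheory.BalabanImbrieJaffe1984to88.BIJ88Result5145Obs
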